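import Literature.NumberTheory.GelbartRogawski1991.UnitaryDualPairThetaKernelCMKType
import Literature.NumberTheory.Automorphic.UnitaryGroupAdelicProduct
import HarnessLib

/-!
# The finite-adelic frame transport `U(H)(𝔸_{L⁺,f}) → U(diag d)(𝔸_{L⁺,f})`, `k ↦ (g_𝔸⁻¹ (1, k) g_𝔸)_f`, is a homeomorphism

Topic `NumberTheory/GelbartRogawski1991`; namespace `Literature.NumberTheory.GelbartRogawski1991.UnitaryDualPair` (sibling of
`UnitaryDualPairThetaKernelCMKType`: the currency conversion `cmKTypeHom L H g d hg : U(H)(𝔸_{L⁺}) →* U(diag d)(𝔸_{L⁺})`, `x ↦ g_𝔸⁻¹ x g_𝔸`,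
for a frame `ᵗḡ H g = diag d`).  KERNEL only: theorems about the composite homomorphism
`finPart ∘ cmKTypeHom ∘ finAdelicToAdelic` (the HC_CM package's `HodgeCM.Model.finFrameCongr`, the pin's `ιVE V`, are this term):

* `archPart_cmKTypeHom_finAdelicToAdelic` — `(g_𝔸⁻¹ (1, k) g_𝔸)_∞ = 1` (conjugation by `g_𝔸 = (g_∞, g_f)` is componentwise), and the same for
  the inverse conversion `(cmFrameEquiv …).symm`;
* `finAdelicToAdelic_finPart_cmKTypeHom_finAdelicToAdelic` — hence `(1, (g_𝔸⁻¹ (1,k) g_𝔸)_f) = g_𝔸⁻¹ (1, k) g_𝔸`;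
* `finPart_cmKTypeHom_finAdelicToAdelic_leftInverse ∕ _rightInverse` — the transport for `g` and the inverse conversion are mutually
  inverse on the finite points;
* **`isHomeomorph_finPart_cmKTypeHom_finAdelicToAdelic`**, **`isOpenMap_finPart_cmKTypeHom_finAdelicToAdelic`**,
  `finPart_cmKTypeHom_finAdelicToAdelic_surjective` — the finite frame transport is a homeomorphism, in particular OPEN and onto.

Use (HC_CM programme, COR-CM pin, X3-Char item (F)): the smooth-splitting normal form of [GelbartRogawski1991, §3.1 Remark p. 457]
(`WeilCoinv.exists_eq_twist_openKer_of_smooth_comp`) yields triviality of a character on an open subgroup of `U(V.Hm)(𝔸_f)` read THROUGH the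
transport; the automatic-continuity statement `UnitaryGroupDualPairLine.continuous_pair_of_level_of_continuous_centre` wants an open LEVEL
of `U(diag d)(𝔸_f)` — the image, open by this file.  Nothing here is specific to rank `3`.

References: [BorelJacquet1979] A. Borel, H. Jacquet, *Automorphic forms and automorphic representations*, Proc. Sympos. Pure Math. 33.1
(1979), §4.1 (`G(𝐀) = G_∞ × G(𝐀_f)`); [PlatonovRapinchuk1994] V. Platonov, A. Rapinchuk, *Algebraic Groups and Number Theory*, Academic
Press 1994, §5.1 (adelic points of algebraic groups; conjugation by rational points); [GelbartRogawski1991] S. Gelbart, J. Rogawski,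
Invent. Math. 105 (1991), §3.1 Remark p. 457 L4–13.
-/

set_option autoImplicit false

noncomputable section

open scoped Matrix
open NumberField NumberField.mixedEmbedding
open Literature.NumberTheory.Automorphic

namespace Literature.NumberTheory.GelbartRogawski1991

namespace UnitaryDualPair

section FinFrame

variable (L : Type) [Field L] [NumberField L] [IsCMField L] {N : ℕ} (H : Matrix (Fin N) (Fin N) L)
  (g : GL (Fin N) L) (d : Fin N → L)
  (hg : ((g : Matrix (Fin N) (Fin N) L).map (cmConjRingHom L))ᵀ * H * (g : Matrix (Fin N) (Fin N) L) =
    Matrix.diagonal d)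


/-- **`(g_𝔸⁻¹ x g_𝔸)_∞ = g_∞⁻¹ x_∞ g_∞`**: the archimedean part of the conversion is conjugation by `g_∞` — in particular it is `1` iff
`x_∞ = 1`. [cite: BorelJacquet1979, §4.1] -/
theorem coe_archPart_cmKTypeHom (x : ↥(UnitaryGroup.adelic (↥(maximalRealSubfield L)) L (IsCMField.complexConj L) N H)) :
    ((UnitaryGroup.archPart (↥(maximalRealSubfield L)) L (IsCMField.complexConj L) N (Matrix.diagonal d) (cmKTypeHom L H g d hg x) :
        ↥(UnitaryGroup.arch (↥(maximalRealSubfield L)) L (IsCMField.complexConj L) N (Matrix.diagonal d))) : GL (Fin N) (mixedSpace L)) =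
      (GLn.toMixed N L (toAdeleGL L g))⁻¹ *
        ((UnitaryGroup.archPart (↥(maximalRealSubfield L)) L (IsCMField.complexConj L) N H x : ↥(UnitaryGroup.arch (↥(maximalRealSubfield L)) L (IsCMField.complexConj L) N H)) : GL (Fin N) (mixedSpace L)) *
          GLn.toMixed N L (toAdeleGL L g) := by
  rw [UnitaryGroup.coe_archPart, UnitaryGroup.coe_archPart]
  change GLn.toMixed N L ((cmKTypeHom L H g d hg x : ↥(UnitaryGroup.adelic (↥(maximalRealSubfield L)) L (IsCMField.complexConj L) N (Matrix.diagonal d))) :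
      GL (Fin N) (AdeleRing (𝓞 L) L)) = _
  rw [coe_cmKTypeHom, map_mul, map_mul, map_inv]
  rfl

/-- **`(g_𝔸⁻¹ (1, k) g_𝔸)_∞ = 1`**: the conversion of a finite-adelic element has trivial archimedean part. [cite: BorelJacquet1979, §4.1] -/
theorem archPart_cmKTypeHom_finAdelicToAdelic (k : ↥(UnitaryGroup.finAdelic (↥(maximalRealSubfield L)) L (IsCMField.complexConj L) N H)) :
    UnitaryGroup.archPart (↥(maximalRealSubfield L)) L (IsCMField.complexConj L) N (Matrix.diagonal d)
        (cmKTypeHom L H g d hg (UnitaryGroup.finAdelicToAdelic (↥(maximalRealSubfield L)) L (IsCMField.complexConj L) N H k)) = 1 := by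
  apply Subtype.ext
  rw [coe_archPart_cmKTypeHom, UnitaryGroup.archPart_finAdelicToAdelic]
  simp

/-- an element of `U(J)(𝔸)` with trivial archimedean part IS its finite part: `(1, x_f) = x`. [cite: BorelJacquet1979, §4.1] -/
theorem finAdelicToAdelic_finPart_of_archPart_eq_one {J : Matrix (Fin N) (Fin N) L} (x : ↥(UnitaryGroup.adelic (↥(maximalRealSubfield L)) L (IsCMField.complexConj L) N J))
    (hx : UnitaryGroup.archPart (↥(maximalRealSubfield L)) L (IsCMField.complexConj L) N J x = 1) :
    UnitaryGroup.finAdelicToAdelic (↥(maximalRealSubfield L)) L (IsCMField.complexConj L) N J (UnitaryGroup.finPart (↥(maximalRealSubfield L)) L (IsCMField.complexConj L) N J x) = x := by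
  have h := UnitaryGroup.archToAdelic_mul_finAdelicToAdelic (↥(maximalRealSubfield L)) L (IsCMField.complexConj L) N J x
  rwa [hx, map_one, one_mul] at h

/-- **`(1, (g_𝔸⁻¹ (1, k) g_𝔸)_f) = g_𝔸⁻¹ (1, k) g_𝔸`**. [cite: BorelJacquet1979, §4.1] -/
theorem finAdelicToAdelic_finPart_cmKTypeHom_finAdelicToAdelic (k : ↥(UnitaryGroup.finAdelic (↥(maximalRealSubfield L)) L (IsCMField.complexConj L) N H)) :
    UnitaryGroup.finAdelicToAdelic (↥(maximalRealSubfield L)) L (IsCMField.complexConj L) N (Matrix.diagonal d)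
        (UnitaryGroup.finPart (↥(maximalRealSubfield L)) L (IsCMField.complexConj L) N (Matrix.diagonal d)
          (cmKTypeHom L H g d hg (UnitaryGroup.finAdelicToAdelic (↥(maximalRealSubfield L)) L (IsCMField.complexConj L) N H k))) =
      cmKTypeHom L H g d hg (UnitaryGroup.finAdelicToAdelic (↥(maximalRealSubfield L)) L (IsCMField.complexConj L) N H k) :=
  finAdelicToAdelic_finPart_of_archPart_eq_one L _ (archPart_cmKTypeHom_finAdelicToAdelic L H g d hg k)

/-- the inverse conversion `(cmFrameEquiv …).symm` (conjugation by `g_𝔸`) also preserves «archimedean part `= 1`» on finite-adelic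
elements: if `cmKTypeHom z = (1, k')` then `z_∞ = 1`. [cite: BorelJacquet1979, §4.1] -/
theorem archPart_eq_one_of_cmKTypeHom_eq_finAdelicToAdelic (z : ↥(UnitaryGroup.adelic (↥(maximalRealSubfield L)) L (IsCMField.complexConj L) N H))
    (k' : ↥(UnitaryGroup.finAdelic (↥(maximalRealSubfield L)) L (IsCMField.complexConj L) N (Matrix.diagonal d)))
    (hz : cmKTypeHom L H g d hg z = UnitaryGroup.finAdelicToAdelic (↥(maximalRealSubfield L)) L (IsCMField.complexConj L) N (Matrix.diagonal d) k') :
    UnitaryGroup.archPart (↥(maximalRealSubfield L)) L (IsCMField.complexConj L) N H z = 1 := by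
  have h := coe_archPart_cmKTypeHom L H g d hg z
  rw [hz, UnitaryGroup.archPart_finAdelicToAdelic, OneMemClass.coe_one] at h
  -- `1 = a⁻¹ * z_∞ * a` ⇒ `z_∞ = 1`
  apply Subtype.ext
  have h' := congrArg (fun y => GLn.toMixed N L (toAdeleGL L g) * y * (GLn.toMixed N L (toAdeleGL L g))⁻¹) h
  simp only [mul_one, mul_inv_cancel, ← mul_assoc, mul_inv_cancel_right, one_mul] at h'
  simpa using h'.symm

/-- **THE FINITE FRAME TRANSPORT IS A HOMEOMORPHISM**: `k ↦ (g_𝔸⁻¹ (1, k) g_𝔸)_f : U(H)(𝔸_{L⁺,f}) → U(diag d)(𝔸_{L⁺,f})` has the continuous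
two-sided inverse `k' ↦ (g_𝔸 (1, k') g_𝔸⁻¹)_f`. [cite: BorelJacquet1979, §4.1] [cite: PlatonovRapinchuk1994, §5.1] -/
theorem isHomeomorph_finPart_cmKTypeHom_finAdelicToAdelic :
    IsHomeomorph ((UnitaryGroup.finPart (↥(maximalRealSubfield L)) L (IsCMField.complexConj L) N (Matrix.diagonal d)).comp
      ((cmKTypeHom L H g d hg).comp (UnitaryGroup.finAdelicToAdelic (↥(maximalRealSubfield L)) L (IsCMField.complexConj L) N H))) := by
  -- the inverse conversion `y ↦ g_𝔸 y g_𝔸⁻¹`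
  let inv : ↥(UnitaryGroup.adelic (↥(maximalRealSubfield L)) L (IsCMField.complexConj L) N (Matrix.diagonal d)) →* ↥(UnitaryGroup.adelic (↥(maximalRealSubfield L)) L (IsCMField.complexConj L) N H) :=
    (cmAdelicEquiv L N H).toMonoidHom.comp (cmFrameEquiv L g H d hg).symm.toMonoidHom
  have hinv₁ : ∀ x, inv (cmKTypeHom L H g d hg x) = x := fun x => by
    change cmAdelicEquiv L N H ((cmFrameEquiv L g H d hg).symm (cmFrameEquiv L g H d hg ((cmAdelicEquiv L N H).symm x))) = x
    rw [ContinuousMulEquiv.symm_apply_apply, ContinuousMulEquiv.apply_symm_apply]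
  have hinv₂ : ∀ y, cmKTypeHom L H g d hg (inv y) = y := fun y => by
    change cmFrameEquiv L g H d hg ((cmAdelicEquiv L N H).symm (cmAdelicEquiv L N H ((cmFrameEquiv L g H d hg).symm y))) = y
    rw [ContinuousMulEquiv.symm_apply_apply, ContinuousMulEquiv.apply_symm_apply]
  have hinvc : Continuous inv :=
    (cmAdelicEquiv L N H).continuous.comp (cmFrameEquiv L g H d hg).symm.continuous
  -- the candidate inverse on the finite points
  let f' : ↥(UnitaryGroup.finAdelic (↥(maximalRealSubfield L)) L (IsCMField.complexConj L) N (Matrix.diagonal d)) → ↥(UnitaryGroup.finAdelic (↥(maximalRealSubfield L)) L (IsCMField.complexConj L) N H) := fun k' =>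
    UnitaryGroup.finPart (↥(maximalRealSubfield L)) L (IsCMField.complexConj L) N H (inv (UnitaryGroup.finAdelicToAdelic (↥(maximalRealSubfield L)) L (IsCMField.complexConj L) N (Matrix.diagonal d) k'))
  have hf'c : Continuous f' :=
    (UnitaryGroup.continuous_finPart (↥(maximalRealSubfield L)) L (IsCMField.complexConj L) N H).comp
      (hinvc.comp (UnitaryGroup.continuous_finAdelicToAdelic (↥(maximalRealSubfield L)) L (IsCMField.complexConj L) N (Matrix.diagonal d)))
  refine isHomeomorph_iff_exists_inverse.2 ⟨?_, f', ?_, ?_, hf'c⟩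
  · exact (UnitaryGroup.continuous_finPart (↥(maximalRealSubfield L)) L (IsCMField.complexConj L) N _).comp
      ((continuous_cmKTypeHom L H g d hg).comp (UnitaryGroup.continuous_finAdelicToAdelic (↥(maximalRealSubfield L)) L (IsCMField.complexConj L) N H))
  · -- left inverse: `f' (f k) = k`
    intro k
    change UnitaryGroup.finPart (↥(maximalRealSubfield L)) L (IsCMField.complexConj L) N H (inv (UnitaryGroup.finAdelicToAdelic (↥(maximalRealSubfield L)) L (IsCMField.complexConj L) N (Matrix.diagonal d)
      (UnitaryGroup.finPart (↥(maximalRealSubfield L)) L (IsCMField.complexConj L) N (Matrix.diagonal d)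
        (cmKTypeHom L H g d hg (UnitaryGroup.finAdelicToAdelic (↥(maximalRealSubfield L)) L (IsCMField.complexConj L) N H k))))) = k
    rw [finAdelicToAdelic_finPart_cmKTypeHom_finAdelicToAdelic, hinv₁, UnitaryGroup.finPart_finAdelicToAdelic]
  · -- right inverse: `f (f' k') = k'`
    intro k'
    change UnitaryGroup.finPart (↥(maximalRealSubfield L)) L (IsCMField.complexConj L) N (Matrix.diagonal d) (cmKTypeHom L H g d hg (UnitaryGroup.finAdelicToAdelic (↥(maximalRealSubfield L)) L (IsCMField.complexConj L) N H
      (UnitaryGroup.finPart (↥(maximalRealSubfield L)) L (IsCMField.complexConj L) N H (inv (UnitaryGroup.finAdelicToAdelic (↥(maximalRealSubfield L)) L (IsCMField.complexConj L) N (Matrix.diagonal d) k'))))) = k'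
    rw [finAdelicToAdelic_finPart_of_archPart_eq_one L _
      (archPart_eq_one_of_cmKTypeHom_eq_finAdelicToAdelic L H g d hg _ k' (hinv₂ _)), hinv₂, UnitaryGroup.finPart_finAdelicToAdelic]

/-- **the finite frame transport is an OPEN map.** [cite: BorelJacquet1979, §4.1] [cite: PlatonovRapinchuk1994, §5.1] -/
theorem isOpenMap_finPart_cmKTypeHom_finAdelicToAdelic :
    IsOpenMap ((UnitaryGroup.finPart (↥(maximalRealSubfield L)) L (IsCMField.complexConj L) N (Matrix.diagonal d)).comp
      ((cmKTypeHom L H g d hg).comp (UnitaryGroup.finAdelicToAdelic (↥(maximalRealSubfield L)) L (IsCMField.complexConj L) N H))) :=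
  (isHomeomorph_finPart_cmKTypeHom_finAdelicToAdelic L H g d hg).isOpenMap

/-- **the finite frame transport is onto.** [cite: BorelJacquet1979, §4.1] [cite: PlatonovRapinchuk1994, §5.1] -/
theorem finPart_cmKTypeHom_finAdelicToAdelic_surjective :
    Function.Surjective ((UnitaryGroup.finPart (↥(maximalRealSubfield L)) L (IsCMField.complexConj L) N (Matrix.diagonal d)).comp
      ((cmKTypeHom L H g d hg).comp (UnitaryGroup.finAdelicToAdelic (↥(maximalRealSubfield L)) L (IsCMField.complexConj L) N H))) :=
  (isHomeomorph_finPart_cmKTypeHom_finAdelicToAdelic L H g d hg).surjective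

/-- the finite frame transport is continuous. [cite: BorelJacquet1979, §4.1] -/
theorem continuous_finPart_cmKTypeHom_finAdelicToAdelic :
    Continuous ((UnitaryGroup.finPart (↥(maximalRealSubfield L)) L (IsCMField.complexConj L) N (Matrix.diagonal d)).comp
      ((cmKTypeHom L H g d hg).comp (UnitaryGroup.finAdelicToAdelic (↥(maximalRealSubfield L)) L (IsCMField.complexConj L) N H))) :=
  (isHomeomorph_finPart_cmKTypeHom_finAdelicToAdelic L H g d hg).continuous

end FinFrame

end UnitaryDualPair

end Literature.NumberTheory.GelbartRogawski1991

end
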